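import Mathlib.Algebra.Polynomial.Roots
import Mathlib.Algebra.MvPolynomial.Equiv
import Literature.Computability.AlgebraicComplexity.TauConjecture
import Literature.Computability.AlgebraicComplexity.ConstantFreeCircuits
import HarnessLib

/-!
# The Shub–Smale τ-conjecture: transcription certificate (and status)

Companion file of `Literature.Computability.AlgebraicComplexity.TauConjecture` for the named
conjecture `Literature.Computability.AlgebraicComplexity.ShubSmaleTauConjecture` (Shub–Smale,
Duke Math. J. 81 (1995) 47–54).

**Status (re-checked 2026-08): OPEN.** The τ-conjecture is stated as a conjecture in Bürgisser's
2024 survey (arXiv:2406.06217, §4.6 "Tau Conjectures": "The τ-conjecture claims …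
`z(f) ≤ (1 + τ(f))^c` for some universal constant `c > 0`", `z(f)` the number of distinct integer
roots of a nonzero `f ∈ ℤ[x]`, `τ(f)` the minimal size of a constant-free circuit, free constants
`-1, 0, 1`); Koiran (ICS 2011, §6): "the question is of course still wide open"; it is Smale's 4th
problem (Borchert–McKenzie–Reinhardt, MFCS 2009, p. 163). Hence, per CONVENTIONS §4 ("open
conjectures are `def … : Prop`, never asserted"), there is **no** `ShubSmaleTauConjecture_holds`;
users keep `(h : ShubSmaleTauConjecture)` as an explicit hypothesis (Bürgisser's transfer theorem
`not_isPBounded_constantFreeComplexity_perPoly_of_tauConjecture`, the barrier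
`Literature/Barriers/ValiantsHypothesis/TauRealZeros.lean`).

What this file PROVES is that the tree's rendering is the printed statement:

* `eq_of_constantFreeComplexity_eq_zero` — the polynomials of constant-free complexity `0` are the
  inputs of the model, `X i`, `0`, `1`, `-1` (a size-`0` circuit has no gates);
* `card_roots_toFinset_le_one_of_constantFreeComplexity_eq_zero` — hence a nonzero `f ∈ ℤ[X]`
  with `τ(f) = 0` has at most one integer zero;
* `shubSmaleTauConjecture_iff_one_add_pow` — `ShubSmaleTauConjecture` (base `τ(f) + 2`) is
  equivalent to the printed form `∃ c, ∀ f ≠ 0, z(f) ≤ (1 + τ(f))^c` with `τ` the tree's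
  `constantFreeComplexity` (Shub–Smale's `τ` up to a factor `≤ 3`, see `TauConjecture.lean`;
  the `∃ c` form is invariant under such factors).

Deliberately NOT here: any assertion of the conjecture; the folklore bound `z(f) ≤ deg f ≤ 2^{τ(f)}`
(available as `totalDegree_eval_le_two_pow_size` in `BurgisserBooleanPartsA3Steps.lean`,
not re-exported to keep this file's imports light).

## References

* M. Shub, S. Smale, *On the intractability of Hilbert's Nullstellensatz and an algebraic version
  of "NP ≠ P?"*, Duke Math. J. 81 (1995) 47–54 (bib key `ShubSmale1995`; not held 2026-08).
* P. Bürgisser, *Completeness classes in algebraic complexity theory*, arXiv:2406.06217 (2024),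
  §4.6, the displayed τ-conjecture and Thm. 4.17 (bib key `Burgisser2024Completeness`).
* P. Koiran, *Shallow circuits with high-powered inputs*, ICS 2011 (arXiv:1004.4960v4), §6.
* B. Borchert, P. McKenzie, K. Reinhardt, *Few product gates but many zeros*, MFCS 2009,
  LNCS 5734, pp. 162–174, p. 163 (the `(τ(f)+1)^β` form, "Smale named the τ-conjecture the
  fourth most important millennium mathematical challenge").
* P. Bürgisser, *Completeness and Reduction in Algebraic Complexity Theory*, Springer 2000, §1.4
  (constant-free model: inputs are the variables and `0, ±1`).
-/

noncomputable section

open Polynomial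

namespace Literature.Computability.AlgebraicComplexity

/-! ### Transcription check for `ShubSmaleTauConjecture` -/

/-- The polynomials of constant-free complexity `0` are exactly what a gate-free circuit can
output: an input variable `X i` or one of the free constants `0, 1, -1` (Bürgisser 2000, §1.4:
in the constant-free model the inputs are the variables and the constants `0, ±1`; a circuit of
size `0` has no gates, so its output operand is an input, or a dangling gate reference whose
junk value is `0`). Uses that `constantFreeComplexity` is attained over `ℤ`
(`ArithCircuit.exists_computes_size_eq_constantFreeComplexity`). [cite: Burgisser2000, §1.4] -/
theorem eq_of_constantFreeComplexity_eq_zero {σ : Type*} {g : MvPolynomial σ ℤ}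
    (h : constantFreeComplexity g = 0) :
    (∃ i, g = MvPolynomial.X i) ∨ g = 0 ∨ g = 1 ∨ g = -1 := by
  obtain ⟨P, -, hs, hc, hsize⟩ := ArithCircuit.exists_computes_size_eq_constantFreeComplexity g
  rw [h] at hsize
  have hg : P.gates = [] := List.eq_nil_of_length_eq_zero hsize
  have hev : g = P.output.eval [] := by
    rw [← hc, ArithCircuit.eval, hg]
    rfl
  have hout := hs.2
  revert hout hev
  cases P.output with
  | var i => intro hev _; exact Or.inl ⟨i, hev⟩
  | const c =>
    intro hev hout
    rcases hout with h0 | h1 | hm1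
    · subst h0; right; left; rw [hev]; simp [ArithCircuit.Operand.eval]
    · subst h1; right; right; left; rw [hev]; simp [ArithCircuit.Operand.eval]
    · have : c = -1 := by omega
      subst this; right; right; right; rw [hev]; simp [ArithCircuit.Operand.eval]
  | gate j => intro hev _; right; left; rw [hev]; simp [ArithCircuit.Operand.eval]

/-- A nonzero `f ∈ ℤ[X]` with `τ(f) = 0` is `X`, `1` or `-1`, so it has at most one integer zero
(the case `τ(f) = 0` of the comparison between the bases `τ(f) + 2` and `1 + τ(f)`). [folklore] -/
theorem card_roots_toFinset_le_one_of_constantFreeComplexity_eq_zero {f : Polynomial ℤ}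
    (hf : f ≠ 0)
    (h : constantFreeComplexity ((MvPolynomial.uniqueAlgEquiv ℤ (Fin 1)).symm f) = 0) :
    f.roots.toFinset.card ≤ 1 := by
  have hf' : f = MvPolynomial.uniqueAlgEquiv ℤ (Fin 1)
      ((MvPolynomial.uniqueAlgEquiv ℤ (Fin 1)).symm f) := (AlgEquiv.apply_symm_apply _ _).symm
  rcases eq_of_constantFreeComplexity_eq_zero h with ⟨i, hi⟩ | h0 | h1 | hm1
  · rw [hi] at hf'
    have : f = X := by rw [hf']; simp [MvPolynomial.uniqueAlgEquiv_apply]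
    rw [this, roots_X]
    simp
  · rw [h0, map_zero] at hf'
    exact absurd hf' hf
  · rw [h1, map_one] at hf'
    rw [hf', roots_one]
    simp
  · rw [hm1, map_neg, map_one] at hf'
    rw [hf', roots_neg, roots_one]
    simp

/-- Transcription check: `ShubSmaleTauConjecture` (base `τ(f) + 2`) is equivalent to the form in
print, "`z(f) ≤ (1 + τ(f))^c` for some universal constant `c`" (Bürgisser, *Completeness classes
in algebraic complexity theory*, arXiv:2406.06217, §4.6; likewise Bürgisser 2009, §1), with `τ`
the tree's `constantFreeComplexity`. One direction is monotonicity of `(·) ^ c`; for the other,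
`τ + 2 ≤ (1 + τ)^2` once `τ ≥ 1`, and `τ(f) = 0` forces `f ∈ {X, 1, -1}`, which have at most one
integer zero (`card_roots_toFinset_le_one_of_constantFreeComplexity_eq_zero`). This certifies the
rendering only; the conjecture itself is open and is not asserted.
[cite: Burgisser2024Completeness, §4.6] -/
theorem shubSmaleTauConjecture_iff_one_add_pow :
    ShubSmaleTauConjecture ↔
      ∃ c : ℕ, ∀ f : Polynomial ℤ, f ≠ 0 →
        f.roots.toFinset.card ≤
          (1 + constantFreeComplexity ((MvPolynomial.uniqueAlgEquiv ℤ (Fin 1)).symm f)) ^ c := by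
  constructor
  · rintro ⟨c, hc⟩
    refine ⟨2 * c, fun f hf => ?_⟩
    rcases Nat.eq_zero_or_pos
        (constantFreeComplexity ((MvPolynomial.uniqueAlgEquiv ℤ (Fin 1)).symm f)) with h0 | hpos
    · rw [h0]
      calc f.roots.toFinset.card ≤ 1 :=
            card_roots_toFinset_le_one_of_constantFreeComplexity_eq_zero hf h0
        _ ≤ (1 + 0) ^ (2 * c) := by rw [add_zero, one_pow]
    · calc f.roots.toFinset.card
          ≤ (constantFreeComplexity ((MvPolynomial.uniqueAlgEquiv ℤ (Fin 1)).symm f) + 2) ^ c :=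
            hc f hf
        _ ≤ ((1 + constantFreeComplexity
              ((MvPolynomial.uniqueAlgEquiv ℤ (Fin 1)).symm f)) ^ 2) ^ c :=
            Nat.pow_le_pow_left (by nlinarith) c
        _ = (1 + constantFreeComplexity
              ((MvPolynomial.uniqueAlgEquiv ℤ (Fin 1)).symm f)) ^ (2 * c) := by
            rw [← pow_mul]
  · rintro ⟨c, hc⟩
    refine ⟨c, fun f hf => (hc f hf).trans ?_⟩
    exact Nat.pow_le_pow_left (by omega) c

end Literature.Computability.AlgebraicComplexity
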